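import Summits.SmoothPoincare4.SmoothPoincare4.Theorems.SymplecticOrigamiNoGenusTwoDoorReductionR3
import Summits.SmoothPoincare4.SmoothPoincare4.Theorems.SymplecticOrigamiNoGenusTwoDoorStubTaubesCanonicalCurveOfLiLiu
import Summits.SmoothPoincare4.SmoothPoincare4.Theorems.SymplecticOrigamiNoGenusTwoDoorStubLiouvillePackagingHolds
import HarnessLib

/-!
# `NoGenusTwoDoor` ⟸ the flat filling exclusion, modulo Hirzebruch and Li–Liu only (line
`canonical-cap-filling`, crux stmt-SmoothPoincare4-7842, lead reshape r3)

Route `SymplecticOrigami`, crux D = `NoGenusTwoDoor` (no closed connected symplectic 4-manifold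
`(N, s)` has `(rank H₁, rank H₂) = (2, 1)`).  `SymplecticOrigamiNoGenusTwoDoorReductionR3.lean`
(p140931) reduced D to the line's transfer target C⁺ = FLAT FILLING EXCLUSION modulo the one
umbrella named fact `taubes_canonicalClass_symplecticCurve_four`, i.e. (by the tree's
`…_of_split`) modulo Hirzebruch's `c₁² = 2χ + 3σ`, Taubes 1995 Thm. A (1) for `b⁺ ≥ 2` and Li–Liu
1995 for `b⁺ = 1`.  A door has `b₂ = 1`, hence `b⁺ = 1`, so Taubes's `b⁺ ≥ 2` theorem is idle:
`stub_taubesCanonicalCurve_of_liLiu` (p141385) produces the canonical genus-2 curve of a door from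
Hirzebruch and Li–Liu alone.  This file records the resulting sharpest reductions of the tree
(kernel-checked, no `sorry`):

* `noGenusTwoDoor_of_flatFillingExclusion_of_hirzebruch_of_liLiu` — C⁺ ⇒ D modulo EXACTLY
  `hirzebruch_firstChernClass_sq_eq_almostComplex_four` (McDuff–Salamon 2017, Rem. 4.1.10
  eq. (4.1.7)) and `liLiu1995_hasTaubesCurve_canonicalClass_of_bPlus_eq_one` (Li–Liu 1995/1999,
  `SW ⇒ Gr` for the canonical class at `b⁺ = 1`; McDuff–Salamon 2017, Thm. 13.3.22, Cor. 13.3.23);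
* `stub_reduction_iff_r3_liLiu` — D ⟺ C⁺ modulo those two facts and `K² = 2χ + 3σ` + adjunction
  (`canonicalClass_sq_and_adjunction_of_symplectic_four`, used only for D ⇒ C⁺) — registered
  sub-goal of the crux item.

Chain: door ⇒ (Hirzebruch, Li–Liu) genus-2 curve `B` with meridian injectivity
(`stub_taubesCanonicalCurve_of_liLiu`) ⇒ exact + flat complement at `b₂ = 1`
(`stub_rankOneFlatComplement`, p90504) ⇒ Liouville packaging (`stub_liouvillePackaging`, p140840,
McLean's Lemma 5.17 discharged) ⇒ contradiction with C⁺.  Sources: the imported files; Taubes 1995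
Thm. A (1); Li–Liu 1995 Thm. 1.2, Cor. 1.3; Li–Liu 1999; McLean 2012 L.5.17; McDuff–Salamon 2017
Rem. 4.1.10, §13.3.
-/

noncomputable section

-- the prescribed namespace `Summit.<P>.<Sub>.…` duplicates `SmoothPoincare4` (P = Sub)
set_option linter.dupNamespace false

open scoped Manifold ContDiff Topology ContinuousMap
open Set Function TopologicalSpace
open Literature.Geometry.Kaehler (MForm IsSmoothForm IsClosedForm mextDeriv)
open Literature.AlgebraicTopology.SingularHomology
open Literature.Topology.FourManifolds (singularHomologyZ)
open Summit.SmoothPoincare4.SmoothPoincare4.Theses.SymplecticOrigami (NoGenusTwoDoor)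

namespace Summit.SmoothPoincare4.SmoothPoincare4.Theorems.NoGenusTwoDoor.CanonicalCapFilling

/-- **C⁺ ⇒ D modulo Hirzebruch and Li–Liu.** The flat filling exclusion implies `NoGenusTwoDoor`,
modulo exactly the two printed theorems a door consumes: Hirzebruch's `c₁² = 2χ + 3σ` for closed
almost complex `4`-manifolds (`hirzebruch_firstChernClass_sq_eq_almostComplex_four`) and Li–Liu's
`SW ⇒ Gr` for the canonical class at `b⁺ = 1`
(`liLiu1995_hasTaubesCurve_canonicalClass_of_bPlus_eq_one`): a door carries the genus-2 curve with
meridian injectivity (`stub_taubesCanonicalCurve_of_liLiu`), at `b₂ = 1` its complement is exact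
and flat (`stub_rankOneFlatComplement`), hence Liouville-packaged (`stub_liouvillePackaging`,
unconditional since McLean's Lemma 5.17 is discharged), which C⁺ forbids.
[cite: LiLiu1999, Main Theorem] [cite: McDuffSalamon2017, Rem. 4.1.10 eq. (4.1.7); Thm. 13.3.22; Cor. 13.3.23]
[cite: Mclean2012, Lemma 5.17] -/
theorem noGenusTwoDoor_of_flatFillingExclusion_of_hirzebruch_of_liLiu
    (hB : Literature.Geometry.Symplectic.hirzebruch_firstChernClass_sq_eq_almostComplex_four)
    (hC₁ : Literature.Geometry.Symplectic.liLiu1995_hasTaubesCurve_canonicalClass_of_bPlus_eq_one)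
    (h4 : (∀ (N : Type) [TopologicalSpace N] [T2Space N] [SecondCountableTopology N] [CompactSpace N]
        [ConnectedSpace N] [ChartedSpace (EuclideanSpace ℝ (Fin 4)) N] [IsManifold (𝓡 4) ∞ N]
        (s : MForm (𝓡 4) N ℝ 2)
        (S : Type) [TopologicalSpace S] [T2Space S] [CompactSpace S] [ConnectedSpace S]
        [ChartedSpace (EuclideanSpace ℝ (Fin 2)) S] [IsManifold (𝓡 2) ∞ S] (b : S → N) (U : Opens N),
        IsSmoothForm s → IsClosedForm s →
        (∀ x (v : TangentSpace (𝓡 4) x), v ≠ 0 → ∃ w, s x ![v, w] ≠ 0) →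
        Module.finrank ℤ (singularHomologyZ S 1) = 4 →
        Manifold.IsSmoothEmbedding (𝓡 2) (𝓡 4) ∞ b →
        (∀ y (v : TangentSpace (𝓡 2) y), v ≠ 0 → ∃ w : TangentSpace (𝓡 2) y,
          s (b y) ![mfderiv (𝓡 2) (𝓡 4) b y v, mfderiv (𝓡 2) (𝓡 4) b y w] ≠ 0) →
        (U : Set N) = (Set.range b)ᶜ →
        Function.Injective (singularHomology.map ℤ ℤ
          (⟨Subtype.val, continuous_subtype_val⟩ : C(↥(Set.range b)ᶜ, N)) 1) →
        (∃ θ : MForm (𝓡 4) U ℝ 1, IsSmoothForm θ ∧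
          mextDeriv θ = s.pullback (𝓡 4) (Subtype.val : U → N)) →
        (∀ x, IsOfFinAddOrder (singularHomology.map ℤ ℤ
          (⟨Subtype.val, continuous_subtype_val⟩ : C(↥(Set.range b)ᶜ, N)) 2 x)) →
        (∀ V : Set N, IsOpen V → Set.range b ⊆ V →
          ∃ (W : Type) (_ : TopologicalSpace W) (_ : T2Space W) (_ : SecondCountableTopology W)
            (_ : CompactSpace W) (_ : ConnectedSpace W) (_ : ChartedSpace (EuclideanHalfSpace 4) W)
            (_ : IsManifold (𝓡∂ 4) ∞ W) (lam : MForm (𝓡∂ 4) W ℝ 1) (ι : W → N),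
            Literature.Geometry.Symplectic.IsLiouvilleDomain W lam ∧
            ContMDiff (𝓡∂ 4) (𝓡 4) ∞ ι ∧ Function.Injective ι ∧
            (∀ x, Function.Injective (mfderiv (𝓡∂ 4) (𝓡 4) ι x)) ∧
            Set.range ι ⊆ (Set.range b)ᶜ ∧ Vᶜ ⊆ Set.range ι ∧
            mextDeriv lam = s.pullback (𝓡∂ 4) ι) →
        False)) :
    NoGenusTwoDoor := by
  intro N _ _ _ _ _ _ _ s hsm hcl hnd hdoor
  obtain ⟨hb1, hb2⟩ := hdoor
  obtain ⟨S, i₁, i₂, i₃, i₄, i₅, i₆, b, hS4, hemb, hsnd, hmer⟩ :=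
    stub_taubesCanonicalCurve_of_liLiu hB hC₁ N s hsm hcl hnd hb1 hb2
  obtain ⟨hexact, hflat⟩ := stub_rankOneFlatComplement N s S b hsm hcl hnd hb2 hemb hsnd
  -- the open complement `N ∖ B` as an open submanifold
  let U : Opens N :=
    ⟨(Set.range b)ᶜ, (isCompact_range hemb.isEmbedding.continuous).isClosed.isOpen_compl⟩
  have hU : (U : Set N) = (Set.range b)ᶜ := rfl
  exact h4 N s S b U hsm hcl hnd hS4 hemb hsnd hU hmer (hexact _ hU) hflat
    (stub_liouvillePackaging N s S b U hsm hcl hnd hemb hsnd hU (hexact _ hU))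

/-- **The transfer is lossless, modulo Hirzebruch, Li–Liu and `K² = 2χ + 3σ`/adjunction**
(registered sub-goal `stub_reduction_iff_r3_liLiu` of the crux item): the crux `NoGenusTwoDoor` is
EQUIVALENT to the flat filling exclusion C⁺ — the one statement left open by the line
`canonical-cap-filling` — granted `hirzebruch_firstChernClass_sq_eq_almostComplex_four`,
`liLiu1995_hasTaubesCurve_canonicalClass_of_bPlus_eq_one` (for C⁺ ⇒ D) and
`canonicalClass_sq_and_adjunction_of_symplectic_four` (for D ⇒ C⁺, `flatFillingExclusion_of_noGenusTwoDoor`).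
[folklore] -/
theorem stub_reduction_iff_r3_liLiu :
    Literature.Geometry.Symplectic.hirzebruch_firstChernClass_sq_eq_almostComplex_four →
    Literature.Geometry.Symplectic.liLiu1995_hasTaubesCurve_canonicalClass_of_bPlus_eq_one →
    Literature.Geometry.Symplectic.canonicalClass_sq_and_adjunction_of_symplectic_four →
    (Summit.SmoothPoincare4.SmoothPoincare4.Theses.SymplecticOrigami.NoGenusTwoDoor ↔
    (∀ (N : Type) [TopologicalSpace N] [T2Space N] [SecondCountableTopology N] [CompactSpace N]
        [ConnectedSpace N] [ChartedSpace (EuclideanSpace ℝ (Fin 4)) N] [IsManifold (𝓡 4) ∞ N]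
        (s : MForm (𝓡 4) N ℝ 2)
        (S : Type) [TopologicalSpace S] [T2Space S] [CompactSpace S] [ConnectedSpace S]
        [ChartedSpace (EuclideanSpace ℝ (Fin 2)) S] [IsManifold (𝓡 2) ∞ S] (b : S → N) (U : Opens N),
        IsSmoothForm s → IsClosedForm s →
        (∀ x (v : TangentSpace (𝓡 4) x), v ≠ 0 → ∃ w, s x ![v, w] ≠ 0) →
        Module.finrank ℤ (singularHomologyZ S 1) = 4 →
        Manifold.IsSmoothEmbedding (𝓡 2) (𝓡 4) ∞ b →
        (∀ y (v : TangentSpace (𝓡 2) y), v ≠ 0 → ∃ w : TangentSpace (𝓡 2) y,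
          s (b y) ![mfderiv (𝓡 2) (𝓡 4) b y v, mfderiv (𝓡 2) (𝓡 4) b y w] ≠ 0) →
        (U : Set N) = (Set.range b)ᶜ →
        Function.Injective (singularHomology.map ℤ ℤ
          (⟨Subtype.val, continuous_subtype_val⟩ : C(↥(Set.range b)ᶜ, N)) 1) →
        (∃ θ : MForm (𝓡 4) U ℝ 1, IsSmoothForm θ ∧
          mextDeriv θ = s.pullback (𝓡 4) (Subtype.val : U → N)) →
        (∀ x, IsOfFinAddOrder (singularHomology.map ℤ ℤ
          (⟨Subtype.val, continuous_subtype_val⟩ : C(↥(Set.range b)ᶜ, N)) 2 x)) →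
        (∀ V : Set N, IsOpen V → Set.range b ⊆ V →
          ∃ (W : Type) (_ : TopologicalSpace W) (_ : T2Space W) (_ : SecondCountableTopology W)
            (_ : CompactSpace W) (_ : ConnectedSpace W) (_ : ChartedSpace (EuclideanHalfSpace 4) W)
            (_ : IsManifold (𝓡∂ 4) ∞ W) (lam : MForm (𝓡∂ 4) W ℝ 1) (ι : W → N),
            Literature.Geometry.Symplectic.IsLiouvilleDomain W lam ∧
            ContMDiff (𝓡∂ 4) (𝓡 4) ∞ ι ∧ Function.Injective ι ∧
            (∀ x, Function.Injective (mfderiv (𝓡∂ 4) (𝓡 4) ι x)) ∧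
            Set.range ι ⊆ (Set.range b)ᶜ ∧ Vᶜ ⊆ Set.range ι ∧
            mextDeriv lam = s.pullback (𝓡∂ 4) ι) →
        False)) :=
  fun hB hC₁ hA => ⟨flatFillingExclusion_of_noGenusTwoDoor hA,
    noGenusTwoDoor_of_flatFillingExclusion_of_hirzebruch_of_liLiu hB hC₁⟩

end Summit.SmoothPoincare4.SmoothPoincare4.Theorems.NoGenusTwoDoor.CanonicalCapFilling

end
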